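import Mathlib
import Summits.Ventures.HodgeRepro2.T5ResidueFieldFinite

/-!
# The inertia degree of an unramified local extension is its degree

Blind cell `pub-hodge-repro2`, seat p8 (gen 13), Tier-5 kernel support.  At an inert place the
record reads `f(E_v / F_v) = [E_v : F_v] = 2` and `q_{E_v} = q_v²` (the residue field of `E_v` is
the quadratic extension of that of `F_v`) — the normalisations of the spherical Hecke algebra and
its Satake parameters use these numbers.  This file derives them from Mathlib's fundamental
identity `e · f = [E : F]` in its local form (`Ideal.ramificationIdx_mul_inertiaDeg_of_isLocalRing`)
with `e = 1` read off `𝔭_{R₀} 𝒪_E = 𝔭_{𝒪_E}` (`T5UnramifiedUniformiser`):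

* `liesOver_maximalIdeal` — `𝔪_E` lies over `𝔭_{R₀}` (for `𝒪_E` local);
* `ramificationIdx'_mul_inertiaDeg'` — `e · f = [E : F]` for `R₀` a DVR, `E / F` finite
  separable, `𝒪_E` local;
* `inertiaDeg'_eq_finrank` / `finrank_residueField_eq` — **`e = 1 ⇒ f = [E : F]`**, i.e.
  `[𝒪_E / 𝔪_E : R₀ / 𝔭] = [E : F]`;
* `finrank_residueField_eq_two` / `natCard_residueField_eq_sq` — the quadratic case: the residue
  field upstairs has degree `2` and `q_E = q_F²` over a finite residue field.

README §8(d): uses an L-value-free non-vanishing device: NO.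
-/

namespace Summit.Ventures.HodgeRepro2.T5InertiaDegree

open IsLocalRing Ideal

variable (R₀ F E : Type*) [CommRing R₀] [IsDomain R₀] [IsDiscreteValuationRing R₀] [Field F]
  [Field E] [Algebra R₀ F] [IsFractionRing R₀ F] [Algebra F E] [Algebra R₀ E]
  [IsScalarTower R₀ F E] [FiniteDimensional F E] [Algebra.IsSeparable F E]
  [IsLocalRing (integralClosure R₀ E)]

omit [FiniteDimensional F E] [Algebra.IsSeparable F E] in
include F in
/-- For `𝒪_E` local, its maximal ideal lies over the maximal ideal of `R₀`. -/
theorem liesOver_maximalIdeal :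
    (maximalIdeal (integralClosure R₀ E)).LiesOver (maximalIdeal R₀) :=
  Ideal.LiesOver.mk <| (maximalIdeal.isMaximal R₀).eq_of_le
    (Ideal.comap_ne_top _ (maximalIdeal.isMaximal _).ne_top)
    (Ideal.le_comap_of_map_le (T5ResidueFieldFinite.map_maximalIdeal_le_maximalIdeal R₀ F E))

include F in
/-- **The fundamental identity in the local case**: `e · f = [E : F]` for the maximal ideals of
`R₀` and `𝒪_E`. -/
theorem ramificationIdx'_mul_inertiaDeg' :
    ramificationIdx' (maximalIdeal R₀) (maximalIdeal (integralClosure R₀ E)) *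
      inertiaDeg' (maximalIdeal R₀) (maximalIdeal (integralClosure R₀ E)) =
        Module.finrank F E := by
  haveI : IsDedekindDomain (integralClosure R₀ E) := integralClosure.isDedekindDomain R₀ F E
  haveI : Module.Finite R₀ (integralClosure R₀ E) :=
    T5ResidueFieldFinite.module_finite_integralClosure R₀ F E
  haveI : IsFractionRing (integralClosure R₀ E) E :=
    integralClosure.isFractionRing_of_finite_extension F E
  exact Ideal.ramificationIdx_mul_inertiaDeg_of_isLocalRing (integralClosure R₀ E) F E
    (IsDiscreteValuationRing.not_a_field R₀)

include F in
/-- **`e = 1 ⇒ f = [E : F]`**: if `𝔭_{R₀} 𝒪_E = 𝔭_{𝒪_E}` then the inertia degree is the degree of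
the extension. -/
theorem inertiaDeg'_eq_finrank
    (hunr : (maximalIdeal R₀).map (algebraMap R₀ (integralClosure R₀ E)) =
      maximalIdeal (integralClosure R₀ E)) :
    inertiaDeg' (maximalIdeal R₀) (maximalIdeal (integralClosure R₀ E)) = Module.finrank F E := by
  haveI := T5UnramifiedUniformiser.isDiscreteValuationRing_integralClosure R₀ F E
  have h := ramificationIdx'_mul_inertiaDeg' R₀ F E
  rwa [T5UnramifiedUniformiser.ramificationIdx'_eq_one_of_map_eq hunr, one_mul] at h

include F in
/-- **`[𝒪_E / 𝔪_E : R₀ / 𝔭] = [E : F]` when `e = 1`** (the residue field upstairs has the degree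
of the extension). -/
theorem finrank_residueField_eq
    (hunr : (maximalIdeal R₀).map (algebraMap R₀ (integralClosure R₀ E)) =
      maximalIdeal (integralClosure R₀ E)) :
    haveI := liesOver_maximalIdeal R₀ F E
    Module.finrank (R₀ ⧸ maximalIdeal R₀)
      (integralClosure R₀ E ⧸ maximalIdeal (integralClosure R₀ E)) = Module.finrank F E := by
  haveI := liesOver_maximalIdeal R₀ F E
  rw [← Ideal.inertiaDeg'_algebraMap]
  exact inertiaDeg'_eq_finrank R₀ F E hunr

include F in
/-- The quadratic case: `f = 2`. -/
theorem finrank_residueField_eq_two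
    (hunr : (maximalIdeal R₀).map (algebraMap R₀ (integralClosure R₀ E)) =
      maximalIdeal (integralClosure R₀ E)) (h2 : Module.finrank F E = 2) :
    haveI := liesOver_maximalIdeal R₀ F E
    Module.finrank (R₀ ⧸ maximalIdeal R₀)
      (integralClosure R₀ E ⧸ maximalIdeal (integralClosure R₀ E)) = 2 := by
  haveI := liesOver_maximalIdeal R₀ F E
  rw [finrank_residueField_eq R₀ F E hunr, h2]

include F in
/-- **`q_E = q_F^{[E : F]}`**: the cardinality of the residue field upstairs when `e = 1`. -/
theorem natCard_residueField_eq_pow [Finite (ResidueField R₀)]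
    (hunr : (maximalIdeal R₀).map (algebraMap R₀ (integralClosure R₀ E)) =
      maximalIdeal (integralClosure R₀ E)) :
    Nat.card (ResidueField (integralClosure R₀ E)) =
      Nat.card (ResidueField R₀) ^ Module.finrank F E := by
  haveI := liesOver_maximalIdeal R₀ F E
  haveI : Module.Finite R₀ (integralClosure R₀ E) :=
    T5ResidueFieldFinite.module_finite_integralClosure R₀ F E
  haveI : Module.Finite R₀
      (integralClosure R₀ E ⧸ maximalIdeal (integralClosure R₀ E)) :=
    Module.Finite.quotient R₀ _
  haveI : Module.Finite (R₀ ⧸ maximalIdeal R₀)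
      (integralClosure R₀ E ⧸ maximalIdeal (integralClosure R₀ E)) :=
    Module.Finite.of_restrictScalars_finite R₀ (R₀ ⧸ maximalIdeal R₀) _
  letI : Module (ResidueField R₀) (ResidueField (integralClosure R₀ E)) :=
    inferInstanceAs (Module (R₀ ⧸ maximalIdeal R₀)
      (integralClosure R₀ E ⧸ maximalIdeal (integralClosure R₀ E)))
  haveI : Module.Finite (ResidueField R₀) (ResidueField (integralClosure R₀ E)) :=
    inferInstanceAs (Module.Finite (R₀ ⧸ maximalIdeal R₀)
      (integralClosure R₀ E ⧸ maximalIdeal (integralClosure R₀ E)))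
  rw [Module.natCard_eq_pow_finrank (K := ResidueField R₀)
    (V := ResidueField (integralClosure R₀ E))]
  congr 1
  exact finrank_residueField_eq R₀ F E hunr

include F in
/-- The quadratic case: `q_E = q_F²`. -/
theorem natCard_residueField_eq_sq [Finite (ResidueField R₀)]
    (hunr : (maximalIdeal R₀).map (algebraMap R₀ (integralClosure R₀ E)) =
      maximalIdeal (integralClosure R₀ E)) (h2 : Module.finrank F E = 2) :
    Nat.card (ResidueField (integralClosure R₀ E)) = Nat.card (ResidueField R₀) ^ 2 := by
  rw [natCard_residueField_eq_pow R₀ F E hunr, h2]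

end Summit.Ventures.HodgeRepro2.T5InertiaDegree
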